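import Summits.KontsevichZagierPeriods.KontsevichZagierPeriods.Theses.IsogenyCertificates
import Summits.KontsevichZagierPeriods.KontsevichZagierPeriods.Theorems.IsogenyCertificatesXMapKernelCellsUnconditional

/-!
# F3 witness (`special`) — the rung family of `Lines/EllipticLogCell.lean` at the floor parameter is a theorem of the tree

Rung family `IncompleteRealPeriodCell W` (line `EllipticLogCell` under the crux `XMapKernel`, stmt-KontsevichZagierPeriods-10663;
typed by the G4 ladder-down seat `fwd-ladder-KontsevichZagierPeriods-10663`, filed by the rung harvest `fwd-harvest-…-10663`).
At the floor parameter `W = wholeWindow = {univ}` the rung IS the landed real-period cell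
`Summit.KontsevichZagierPeriods.IsogenyCertificates.XMapKernelCells.realPeriodCellKernel_relations`
(`Theorems/IsogenyCertificatesXMapKernelCellsUnconditional.lean`, unconditional): the generator sets coincide
(`incompleteGens_wholeWindow`, `ext; simp`) and the floor decl applies. Definitions inlined VERBATIM from the line file
(own sub-namespace `….EllipticLogCell.Special`, so both files can live in one environment).

Second part — same-rung guard (sorry-free form): with the floor decl in scope, `floor → EllipticLogCell` does NOT close by
`exact`, by the η-expanded term, by `simpa [defs] using`, or by `aesop (terminal)`; `exact?` on it times out at whnf under
400000 heartbeats (source seat, recorded in its NOTES) — the ONE move (window class `{univ} → ratWindows`) is real.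
Expected: rc 0, NO sorry; `special` axioms ⊆ {propext, Classical.choice, Quot.sound}.
-/

noncomputable section
namespace Summit.KontsevichZagierPeriods.KontsevichZagierPeriods.Cruxes.XMapKernel.EllipticLogCell.Special
set_option linter.dupNamespace false
set_option linter.unusedVariables false
open Literature.NumberTheory.Transcendental
open Summit.KontsevichZagierPeriods.IsogenyCertificates

def incompleteGens (W : Set (Set ℝ)) : Set KZ.FormalRep :=
  {d | ∃ (A B : ℤ) (a : ℚ) (w : Set ℝ) (r : KZ.IntegralRep 1), 4 * A ^ 3 + 27 * B ^ 2 ≠ 0 ∧ w ∈ W ∧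
    r.domain = {x | x 0 ∈ w ∧ 0 < x 0 ^ 3 + (A : ℝ) * x 0 + (B : ℝ)} ∧
    Set.EqOn r.integrand (fun x => (a : ℝ) / Real.sqrt (x 0 ^ 3 + (A : ℝ) * x 0 + (B : ℝ))) r.domain ∧
    d = KZ.of r}

def IncompleteRealPeriodCell (W : Set (Set ℝ)) : Prop :=
  ∀ c ∈ AddSubgroup.closure (incompleteGens W), KZ.eval c = 0 → c ∈ KZ.relations

def wholeWindow : Set (Set ℝ) := {Set.univ}

def ratWindows : Set (Set ℝ) :=
  {w | ∃ p q : ℚ, w = Set.Ioo (p : ℝ) (q : ℝ)} ∪ {w | ∃ p : ℚ, w = Set.Ioi (p : ℝ)} ∪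
    {w | ∃ q : ℚ, w = Set.Iio (q : ℝ)} ∪ {Set.univ}

def EllipticLogCell : Prop := IncompleteRealPeriodCell ratWindows

/-- The `θ₀` generators are literally the real-period cell's generators. -/
theorem incompleteGens_wholeWindow :
    incompleteGens wholeWindow =
      {d : KZ.FormalRep | ∃ (A B : ℤ) (a : ℚ) (r : KZ.IntegralRep 1), 4 * A ^ 3 + 27 * B ^ 2 ≠ 0 ∧
        r.domain = {x | 0 < x 0 ^ 3 + (A : ℝ) * x 0 + (B : ℝ)} ∧
        Set.EqOn r.integrand (fun x => (a : ℝ) / Real.sqrt (x 0 ^ 3 + (A : ℝ) * x 0 + (B : ℝ))) r.domain ∧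
        d = KZ.of r} := by
  ext d
  simp only [incompleteGens, wholeWindow, Set.mem_setOf_eq, Set.mem_singleton_iff]
  constructor
  · rintro ⟨A, B, a, w, r, hΔ, rfl, hdom, hint, rfl⟩
    refine ⟨A, B, a, r, hΔ, ?_, hint, rfl⟩
    rw [hdom]; ext x; simp
  · rintro ⟨A, B, a, r, hΔ, hdom, hint, rfl⟩
    refine ⟨A, B, a, Set.univ, r, hΔ, rfl, ?_, hint, rfl⟩
    rw [hdom]; ext x; simp

/-- **F3: `Rung θ₀ = IncompleteRealPeriodCell wholeWindow` is the PROVED floor** (the real-period cell). -/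
theorem special : IncompleteRealPeriodCell wholeWindow := by
  intro c hc h0
  rw [incompleteGens_wholeWindow] at hc
  exact XMapKernelCells.realPeriodCellKernel_relations c hc h0

/-- The same as an `example`, in the brief's `simpa … using <floor decl>` shape (after rewriting the generator set). -/
example : IncompleteRealPeriodCell wholeWindow := by
  intro c hc h0
  simpa using XMapKernelCells.realPeriodCellKernel_relations c (by simpa [incompleteGens_wholeWindow] using hc) h0

/-! ### same-rung guard (sorry-free): `floor → next rung` must NOT close cheaply with the floor in scope -/

set_option maxHeartbeats 400000 in
example (hfloor : IncompleteRealPeriodCell wholeWindow) : True := by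
  fail_if_success (have _h : EllipticLogCell := by exact hfloor)
  fail_if_success (have _h : EllipticLogCell := fun c hc h0 => hfloor c hc h0)
  trivial

set_option maxHeartbeats 400000 in
example (hfloor : IncompleteRealPeriodCell wholeWindow) : True := by
  fail_if_success
    (have _h : EllipticLogCell := by
      simpa [EllipticLogCell, IncompleteRealPeriodCell, ratWindows, wholeWindow] using hfloor)
  trivial

set_option maxHeartbeats 400000 in
example (hfloor : IncompleteRealPeriodCell wholeWindow) : True := by
  fail_if_success (have _h : EllipticLogCell := by aesop (config := { terminal := true }))
  trivial

end Summit.KontsevichZagierPeriods.KontsevichZagierPeriods.Cruxes.XMapKernel.EllipticLogCell.Special
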